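import Summits.BirchSwinnertonDyer.BirchSwinnertonDyer.Theorems.ByReductionTypeAtTwoRankOneSigmaHeightLevelOne
import Literature.NumberTheory.EllipticCurves.CanonicalPAdicHeightLocalIndexProofs
import Literature.NumberTheory.EllipticCurves.CanonicalPAdicHeightParallelogramProofs
import HarnessLib

/-!
# Route `ByReductionTypeAtTwo`, crux `RankOneAtTwoBigImageOddLocal` (item stmt-BirchSwinnertonDyer-23715), line AN62, σ₀-LEMMA BLOCK
# (cell `bsd-f1-sign2`, planner seat `-an` g50; `--supports 23715`, helper; sequel of `…SigmaHeightLevelOne`):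
# **LEVEL ONE, part 3: DOUBLING A LEVEL-ONE POINT LANDS IN THE LOCAL-CONDITIONS LOCUS AT 2**

HONEST FRAMING (D-0036/D-0054): THEOREMS ONLY (no definition, no named fact, no `sorry`, no instance).  `V/ℚ` `ℤ`-integral with `a₁ = 0`.
For a non-singular rational point `Q = (x, y)` with `‖x‖₂ = 4` (level one of the formal group at `2`) and non-singular reduction at
every prime: `Q` is not `2`-torsion (`‖y‖₂ = 8` while a `2`-torsion point has `2y = −a₃ ∈ ℤ`), `2Q = (x′, y′)` is affine with
`‖x′‖₂ ≥ 16` (the tree's `four_mul_padicNorm_le_padicNorm_addX`), `z(2Q)` lies in the sigma disc (`inSigmaDisc_two_of_le`), and `2Q`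
has non-singular reduction everywhere (`E₀(ℚ) at ℓ` is the subgroup `nonsingularReductionSubgroupAt`).  Hence `2Q` satisfies the local
conditions at `2` — the closure hypothesis of the level-one law for the `η`-height (workfile `WildPairHeightAN62` §13.5,
`etaHeightLevelOneLawAtTwo_of_neron`), which thereby follows from Néron's duplication numerator ALONE.
Nothing here is a statement about `BSDp`; item 23715 stays OPEN; BSD is proved for no curve.

PLACEMENT: corollary-of-print ∘ kernel.  References: [cite: SilvermanAEC2009, IV.3.2(a), VII.2.1, VII.2.2] [cite: MazurSteinTate2006, §1].
-/

set_option autoImplicit false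

noncomputable section

open scoped Classical

open WeierstrassCurve Literature Literature.NumberTheory.EllipticCurves

namespace Summit.BirchSwinnertonDyer.BirchSwinnertonDyer.Theorems

namespace NaiveSigmaLogAtTwo

/-! ### §8 Doubling a level-one point -/

/-- On a `ℤ`-integral model with `a₁ = 0`, a non-singular rational point `(x, y)` with `‖x‖₂ = 4` has `‖y‖₂ = 8`
(`‖y‖₂² = ‖x‖₂³`). [cite: SilvermanAEC2009, VII.2.2] -/
theorem padicNorm_y_eq_eight_of_norm_eq_four (V : WeierstrassCurve ℚ) [V.IsIntegral ℤ] {x y : ℚ}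
    (h : V.toAffine.Nonsingular x y) (hx : ‖(x : ℚ_[2])‖ = 4) : padicNorm 2 y = 8 := by
  have hx' : padicNorm 2 x = 4 := by
    rw [Padic.eq_padicNorm] at hx; exact_mod_cast hx
  obtain ⟨hsq, -, -⟩ := padicNorm_Y_of_one_lt (W := V) 2 h (by rw [hx']; norm_num)
  rw [hx'] at hsq
  norm_num at hsq
  nlinarith [padicNorm.nonneg (p := 2) y, hsq]

/-- **A level-one point is not `2`-torsion** (`ℤ`-integral model, `a₁ = 0`): if `‖x‖₂ = 4` then `y ≠ −y − a₃`, because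
`2y = −a₃` would force `‖y‖₂ ≤ 2 < 8`. [cite: SilvermanAEC2009, VII.2.2, III.2.3] -/
theorem Y_ne_negY_of_norm_eq_four (V : WeierstrassCurve ℚ) [V.IsIntegral ℤ] (ha1 : V.a₁ = 0) {x y : ℚ}
    (h : V.toAffine.Nonsingular x y) (hx : ‖(x : ℚ_[2])‖ = 4) : y ≠ V.toAffine.negY x y := by
  intro hy
  have hy8 := padicNorm_y_eq_eight_of_norm_eq_four V h hx
  have e : (2 : ℚ) * y = -V.a₃ := by
    rw [WeierstrassCurve.Affine.negY, ha1] at hy; linarith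
  have ha3 : padicNorm 2 (V.a₃ : ℚ) ≤ 1 := by
    rw [← integralModel_a₃_eq ℤ V]; exact padicNorm.of_int _
  have h2 : padicNorm 2 (2 : ℚ) = 2⁻¹ := by
    have := padicNorm.padicNorm_p_of_prime (p := 2); exact_mod_cast this
  have h4 : padicNorm 2 ((2 : ℚ) * y) = 4 := by rw [padicNorm.mul, h2, hy8]; norm_num
  rw [e, padicNorm.neg] at h4
  linarith

/-- **Doubling a level-one point with non-singular reduction everywhere lands in the local-conditions locus at `2`**
(`ℤ`-integral model, `a₁ = 0`): for `Q = (x, y)` non-singular with `‖x‖₂ = 4` and non-singular reduction at every prime,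
`2Q = (x′, y′)` is affine and satisfies the local conditions at `2` (`‖x′‖₂ ≥ 16 > 1`, `z(2Q)` in the sigma disc, non-singular
reduction everywhere). [cite: SilvermanAEC2009, IV.3.2(a), VII.2.1, VII.2.2] -/
theorem exists_two_nsmul_satisfiesLocalConditions_of_norm_eq_four (V : WeierstrassCurve ℚ) [V.IsIntegral ℤ]
    (ha1 : V.a₁ = 0) {x y : ℚ} (h : V.toAffine.Nonsingular x y) (hx : ‖(x : ℚ_[2])‖ = 4)
    (hns : ∀ ℓ : ℕ, ℓ.Prime → V.HasNonsingularReductionAt ℓ x y) :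
    ∃ (x' y' : ℚ) (h' : V.toAffine.Nonsingular x' y'),
      (2 : ℕ) • (.some x y h : V.toAffine.Point) = .some x' y' h' ∧
        V.SatisfiesLocalConditions 2 (.some x' y' h') := by
  have hy := Y_ne_negY_of_norm_eq_four V ha1 h hx
  have h' : V.toAffine.Nonsingular (V.toAffine.addX x x (V.toAffine.slope x x y y))
      (V.toAffine.addY x x y (V.toAffine.slope x x y y)) :=
    WeierstrassCurve.Affine.nonsingular_add h h fun hxy => hy hxy.right
  have h2Q : (2 : ℕ) • (.some x y h : V.toAffine.Point) = .some _ _ h' := by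
    rw [two_nsmul]; exact WeierstrassCurve.Affine.Point.add_self_of_Y_ne hy
  refine ⟨_, _, h', h2Q, ?_⟩
  have hx' : padicNorm 2 x = 4 := by
    rw [Padic.eq_padicNorm] at hx; exact_mod_cast hx
  have h16 : 16 ≤ padicNorm 2 (V.toAffine.addX x x (V.toAffine.slope x x y y)) := by
    have := four_mul_padicNorm_le_padicNorm_addX (W := V) h (by rw [hx']; norm_num) hy
    rw [hx'] at this; linarith
  dsimp only [WeierstrassCurve.SatisfiesLocalConditions]
  refine ⟨?_, inSigmaDisc_two_of_le (W := V) h' h16, fun ℓ hℓ => ?_⟩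
  · rw [Padic.eq_padicNorm]
    exact_mod_cast (show (1 : ℚ) < _ by linarith)
  · haveI : Fact ℓ.Prime := ⟨hℓ⟩
    have hP : (.some x y h : V.toAffine.Point) ∈ V.nonsingularReductionSubgroupAt ℓ :=
      (mem_nonsingularReductionSubgroupAt_iff _).mpr ((V.reducesNonsingularlyAt_some ℓ h).mpr (hns ℓ hℓ))
    have h2P := (V.nonsingularReductionSubgroupAt ℓ).nsmul_mem hP 2
    rw [h2Q, mem_nonsingularReductionSubgroupAt_iff, reducesNonsingularlyAt_some] at h2P
    exact h2P

end NaiveSigmaLogAtTwo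

end Summit.BirchSwinnertonDyer.BirchSwinnertonDyer.Theorems
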